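import Summits.ABC.IUTFork.Joshi.FundamentalEstimateBLFixedRho
import Summits.ABC.IUTFork.Joshi.ThetaJoshiProp661Readings
import HarnessLib

/-!
# [J-III] Thm. 7.3.1 AS TYPED (`FundamentalEstimateBL`) and its local step (`LocalThetaEstimateAt`): what decides them —
# the R-J census rows C-040 / C-054, kernel-backed

Proof-only companion of the abc-iut cell, block E → R-J «JOSHI Y-DISCHARGE CENSUS» (D-0079; rung LADDER-ABC:A2.RESCUE.J; table of
record `HOME/plan/E/R-J/Y-CENSUS.tsv`, census ids C-040 / C-054 of `HOME/plan/E/R-J/census/HYP-CENSUS-E-t27-v1.1.tsv`); seat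
abc-iut-E-t12 (gen 8), whose lineage typed the two Props (slot T-12, `Joshi/FundamentalEstimateBL.lean` p428437):
* C-040 `ATS3.AdelicThetaDatum.FundamentalEstimateBL` — K. Joshi, arXiv:2401.13508**v4** ([J-III]; unrefereed; bib `Joshi2024ATS3`),
  Thm. 7.3.1 p.55 l.1–30 AS TYPED: `∏_{w ∈ 𝕍^{odd,ss}} |q_w|^{ℓ⋆/2ℓ} ≤ |Θ̃^{B_{L′}}_Joshi|_{B_{L′}}`, the size being Def. 7.2.7's `sup` over the
  locus AND over `ρ ∈ (0,1]` (p.54 l.61–76);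
* C-054 `ATS3.AdelicThetaDatum.LocalThetaEstimateAt ρ` — the local step of its proof (p.56 l.38–61): at every bad place the
  `(B_{L′_w},ρ)`-size of the `w`-component of the distinguished element `Ξ^α_{0,z_Θ}` exceeds `|q_w|^{ℓ⋆/2ℓ}`.
Both are `@[claim]`-tagged hypotheses of Statement-bearing test theorems (`ATS3.statement_of_fundamentalEstimateBL`,
`ATS3.statement_of_localThetaEstimateAt`, X-05 p429522) — hence census rows. This file records, IN KERNEL and over the typed
§7 signature only, WHAT DECIDES EACH OF THEM AS TYPED (located, not adjudicated):

1. **C-054 is decided by the READING of Prop. 6.6.1 «`ξ_1 = q`» / p.56 l.29–37** (which object the distinguished element lifts):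
   TRUE at every `ρ ∈ (0,1]` for every `ℓ ≥ 5` under the charitable reading `StandardPointNorms` (lifts of the theta values;
   `localThetaEstimateAt_of_standardPointNorms`, p429865 — on the ACTUAL locus of Def. 6.10.2 from the [J-IIp] prototype theorems
   modulo the located input (STD), `AdelicLiftDatum.localThetaEstimate_of_prototype`, p435150), FALSE at every `ρ` under the LITERAL
   reading `LiteralStandardPointNorms` (lifts of the Tate parameters; abc-iut-E-t11's `not_localThetaEstimateAt_of_literal`,
   p430748). Both BY NAME; restated here only inside the packaging theorem of §5.
2. **C-040 AS TYPED is NOT decided by its local step.** (a) `|Θ̃|_{B_{L′}} = ⊤ ⟹ C-040` (`fundamentalEstimateBL_of_size_eq_top`),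
   and `|Θ̃|_{B_{L′}} = ⊤` follows from ONE member of the locus having ONE coordinate whose `ρ`-norms are unbounded on `(0,1]` while
   the other coordinates at the bad places stay `≥ c > 0` (`size_locus_eq_top_of_unbounded_coordinate`) — the kernel form of
   OUR READING (my lineage's flag file p430788, §1 there: `exists_lt_of_frobeniusScaling`) of Def. 6.4.3.1's lifts
   `[z_j] + i_j(λ)·t_{K_{y′_j}}` with `λ ≠ 0`: `t` is a Frobenius eigenvector, so `|t|_ρ → ∞` as `ρ → 0⁺` by the [FF18] §1.4 scaling,
   and ultrametrically the coordinate's norm dominates `|λ|·|t|_ρ` once that exceeds `|z_j|` (`unbounded_of_dominates_frobeniusScaling`).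
   NO theta value, NO valuation scaling (Thm. 4.2.2.1), NO (STD) and NO choice between the two readings of 1. is read: C-040 as typed
   holds even at a datum where C-054 FAILS at every `ρ` (`eigenDatum`, §4: literal norms at `Ξ^α_{0,z_Θ}` + one eigen-member).
   (b) FIRST NEGATOR of C-040 (the census v1.1 has `negated = 0`): under the LITERAL reading at a datum whose locus is the
   singleton `{Ξ^α_{0,z_Θ}}`, Thm. 7.3.1 FAILS as typed and at every fixed `ρ` (`not_fundamentalEstimateBL_of_literal_of_locus_eq`:
   `|Ξ|_{B_{L′},ρ} ≤ ∏_w |q_w| < ∏_w |q_w|^{ℓ⋆/2ℓ}`); witness `literalDatum` (§4). So, as typed, C-040's truth value is carried by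
   Def. 7.2.7's `sup` over `ρ ∈ (0,1]` together with WHICH lifts Def. 6.10.2 puts in the locus — by the container, not by the
   theta-values inequality its proof exhibits; the content the printed proof actually establishes is the fixed-`ρ` form
   `FundamentalEstimateBLAt ρ` (p432151) through C-054, i.e. it inherits the reading-dependence of 1.
3. Neither Prop is S-bearing by itself (R-J hygiene): toward OUR `Cor312.Setting.Statement` they act only through the volume
   dictionary `VolumeDictionaryBL` (census C-060 = C-041 ∧ C-042; S-BYPASSED shape = SD ⟺ Statement under `ThetaFinite`, FALSE at the
   pinned countermodel for every datum satisfying C-040 — X-05 p429522, BY NAME; not restated here).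

HONEST SCOPE. Interface level over `ATS3.AdelicThetaDatum` (the tree has no Fargues–Fontaine ring); the two witness data of §4 are
interface-level (real numbers), like `toyDatum` (p429522) and `flatDatum` (p430788). No new `Prop`-valued definition: every reading
enters as an explicit binder or BY NAME. No FACT-LIST row consumed; nothing of [J-III]/[J-IIp] asserted. Object-side file
(E-PLAN R14: imports Joshi object files only). TAKES NO SIDE on [IUTchIII] Cor. 3.12, on Joshi's claims or on Mochizuki's report on
them (Mochizuki / Scholze–Stix / Joshi / Dupuy–Hilado); typed ≠ proved ≠ endorsed; NOT an abc claim.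
-/

noncomputable section

open Set Finset

namespace Summit.ABC.IUTFork.Joshi.ATS3

namespace AdelicThetaDatum

variable (D : AdelicThetaDatum)

/-! ## 1. `|Θ̃|_{B_{L′}} = ⊤` decides Thm. 7.3.1 as typed; one unbounded member gives `⊤` -/

/-- **`|Θ̃^{B_{L′}}_Joshi|_{B_{L′}} = ⊤ ⟹ Thm. 7.3.1 AS TYPED`** (`qBound ≤ ⊤`): once Def. 7.2.7's double supremum is infinite the typed
conclusion of Thm. 7.3.1 holds with no input at all. [folklore] -/
theorem fundamentalEstimateBL_of_size_eq_top (h : D.size D.locus = ⊤) : D.FundamentalEstimateBL := by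
  unfold FundamentalEstimateBL; rw [h]; exact le_top

/-- A subset containing ONE member whose `(B_{L′},ρ)`-sizes are unbounded over `ρ ∈ (0,1]` has `|Φ|_{B_{L′}} = ⊤`. [folklore] -/
theorem size_eq_top_of_unbounded_member {Φ : Set D.Tuple} {x : D.Tuple} (hx : x ∈ Φ)
    (h : ∀ M : ℝ, ∃ ρ ∈ Set.Ioc (0 : ℝ) 1, M < D.adelicSize ρ x) : D.size Φ = ⊤ := by
  rw [EReal.eq_top_iff_forall_lt]
  intro M
  obtain ⟨ρ, hρ, hM⟩ := h M
  exact (EReal.coe_lt_coe_iff.2 hM).trans_le (D.adelicSize_le_size hx hρ)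

/-- **Thm. 7.3.1 AS TYPED from ONE member of the locus with unbounded sizes** — no theta value is read. [folklore] -/
theorem fundamentalEstimateBL_of_unbounded_member (z : D.Idx)
    (h : ∀ M : ℝ, ∃ ρ ∈ Set.Ioc (0 : ℝ) 1, M < D.adelicSize ρ (D.Xi z)) : D.FundamentalEstimateBL :=
  D.fundamentalEstimateBL_of_size_eq_top (D.size_eq_top_of_unbounded_member (D.Xi_mem_locus z) h)

/-! ## 2. One unbounded COORDINATE (a Frobenius eigen-component) makes the member's sizes unbounded -/

/-- The `(B_{L′},ρ)`-size of a member of the locus as ONE finite product over (bad place, label). [folklore] -/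
theorem adelicSize_Xi_eq_prod_product (ρ : ℝ) (z : D.Idx) :
    D.adelicSize ρ (D.Xi z) = ∏ p ∈ D.Vss ×ˢ (Finset.univ : Finset (Fin D.lstar)), D.nrm p.1 ρ (D.Xi z p.1 p.2) := by
  rw [D.adelicSize_Xi_eq_prod, Finset.prod_product]
  rfl

/-- **Lower bound through one coordinate**: if every coordinate norm of `Ξ_z` at the bad places is `≥ c ≥ 0` at `ρ`, then for any bad
place `w₀` and label `j₀`, `|Ξ_z|_{B_{L′},ρ} ≥ c^{#𝕍^{odd,ss}·ℓ⋆ − 1} · |Ξ_{z,w₀,j₀}|_{B_{L′_{w₀}},ρ}`. [folklore] -/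
theorem coordinate_mul_le_adelicSize {ρ c : ℝ} (hc : 0 ≤ c) (z : D.Idx) {w₀ : D.W} (hw₀ : w₀ ∈ D.Vss) (j₀ : Fin D.lstar)
    (hlow : ∀ w ∈ D.Vss, ∀ j : Fin D.lstar, c ≤ D.nrm w ρ (D.Xi z w j)) :
    D.nrm w₀ ρ (D.Xi z w₀ j₀) * c ^ (D.Vss.card * D.lstar - 1) ≤ D.adelicSize ρ (D.Xi z) := by
  classical
  set S : Finset (D.W × Fin D.lstar) := D.Vss ×ˢ (Finset.univ : Finset (Fin D.lstar)) with hS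
  have hmem : (w₀, j₀) ∈ S := Finset.mk_mem_product hw₀ (Finset.mem_univ j₀)
  have hcard : S.card = D.Vss.card * D.lstar := by
    rw [hS, Finset.card_product, Finset.card_univ, Fintype.card_fin]
  rw [D.adelicSize_Xi_eq_prod_product, ← Finset.mul_prod_erase S _ hmem]
  refine mul_le_mul_of_nonneg_left ?_ (D.nrm_nonneg _ _ _)
  have hconst : ∏ _p ∈ S.erase (w₀, j₀), c = c ^ (D.Vss.card * D.lstar - 1) := by
    rw [Finset.prod_const, Finset.card_erase_of_mem hmem, hcard]
  rw [← hconst]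
  refine Finset.prod_le_prod (fun _ _ => hc) fun p hp => ?_
  have hp' : p ∈ S := Finset.mem_of_mem_erase hp
  rw [hS, Finset.mem_product] at hp'
  exact hlow p.1 hp'.1 p.2

/-- **One unbounded coordinate ⟹ unbounded sizes**: if the coordinate norms of `Ξ_z` at the bad places are `≥ c > 0` uniformly in
`ρ ∈ (0,1]` and ONE coordinate `(w₀, j₀)` has norms unbounded over `ρ ∈ (0,1]`, the `(B_{L′},ρ)`-sizes of `Ξ_z` are unbounded. [folklore] -/
theorem unbounded_adelicSize_of_unbounded_coordinate (z : D.Idx) {w₀ : D.W} (hw₀ : w₀ ∈ D.Vss) (j₀ : Fin D.lstar) {c : ℝ}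
    (hc : 0 < c) (hlow : ∀ ρ ∈ Set.Ioc (0 : ℝ) 1, ∀ w ∈ D.Vss, ∀ j : Fin D.lstar, c ≤ D.nrm w ρ (D.Xi z w j))
    (hunb : ∀ M : ℝ, ∃ ρ ∈ Set.Ioc (0 : ℝ) 1, M < D.nrm w₀ ρ (D.Xi z w₀ j₀)) :
    ∀ M : ℝ, ∃ ρ ∈ Set.Ioc (0 : ℝ) 1, M < D.adelicSize ρ (D.Xi z) := by
  intro M
  set K : ℝ := c ^ (D.Vss.card * D.lstar - 1) with hK
  have hKpos : 0 < K := pow_pos hc _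
  obtain ⟨ρ, hρ, hM⟩ := hunb (max M 0 / K)
  refine ⟨ρ, hρ, ?_⟩
  have h1 := D.coordinate_mul_le_adelicSize hc.le z hw₀ j₀ (hlow ρ hρ)
  have h2 : max M 0 < D.nrm w₀ ρ (D.Xi z w₀ j₀) * K := by rwa [div_lt_iff₀ hKpos] at hM
  exact (le_max_left M 0).trans_lt (h2.trans_le h1)

/-- **Hence Thm. 7.3.1 AS TYPED from one unbounded coordinate of one member of the locus** (the other coordinates at the bad places
bounded below): `|Θ̃|_{B_{L′}} = ⊤ ≥ qBound`. Nothing about theta values, valuation scaling or (STD) is read. [folklore] -/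
theorem size_locus_eq_top_of_unbounded_coordinate (z : D.Idx) {w₀ : D.W} (hw₀ : w₀ ∈ D.Vss) (j₀ : Fin D.lstar) {c : ℝ}
    (hc : 0 < c) (hlow : ∀ ρ ∈ Set.Ioc (0 : ℝ) 1, ∀ w ∈ D.Vss, ∀ j : Fin D.lstar, c ≤ D.nrm w ρ (D.Xi z w j))
    (hunb : ∀ M : ℝ, ∃ ρ ∈ Set.Ioc (0 : ℝ) 1, M < D.nrm w₀ ρ (D.Xi z w₀ j₀)) : D.size D.locus = ⊤ :=
  D.size_eq_top_of_unbounded_member (D.Xi_mem_locus z) (D.unbounded_adelicSize_of_unbounded_coordinate z hw₀ j₀ hc hlow hunb)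

/-- The same, concluding Thm. 7.3.1 as typed. [folklore] -/
theorem fundamentalEstimateBL_of_unbounded_coordinate (z : D.Idx) {w₀ : D.W} (hw₀ : w₀ ∈ D.Vss) (j₀ : Fin D.lstar) {c : ℝ}
    (hc : 0 < c) (hlow : ∀ ρ ∈ Set.Ioc (0 : ℝ) 1, ∀ w ∈ D.Vss, ∀ j : Fin D.lstar, c ≤ D.nrm w ρ (D.Xi z w j))
    (hunb : ∀ M : ℝ, ∃ ρ ∈ Set.Ioc (0 : ℝ) 1, M < D.nrm w₀ ρ (D.Xi z w₀ j₀)) : D.FundamentalEstimateBL :=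
  D.fundamentalEstimateBL_of_size_eq_top (D.size_locus_eq_top_of_unbounded_coordinate z hw₀ j₀ hc hlow hunb)

/-- **The Frobenius eigen-component reading, kernel form.** If a function `g` on `(0,1)` obeys the [FF18] §1.4 scaling law of a
Frobenius eigenvector (`g(ρ^q) = (g(ρ)/ρ)^q`, `q ≥ 1`, `g > 0` somewhere — e.g. `g(ρ) = |λ|·|t_{K_{y′}}|_ρ`, Def. 6.4.3.1 with `λ ≠ 0`)
and the coordinate norm `ρ ↦ |Ξ_{z,w₀,j₀}|_{B,ρ}` DOMINATES `g` as soon as `g` exceeds a threshold `A` (ultrametric reading of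
`|[z_j] + i_j(λ) t|_ρ` once `|λ t|_ρ > |z_j| =: A`), then that coordinate's norms are unbounded over `ρ ∈ (0,1]`
(`exists_lt_of_frobeniusScaling`, p430788). [folklore] -/
theorem unbounded_of_dominates_frobeniusScaling (z : D.Idx) (w₀ : D.W) (j₀ : Fin D.lstar) {q : ℕ} (hq : 1 ≤ q) {g : ℝ → ℝ}
    (hscale : ∀ ρ ∈ Set.Ioo (0 : ℝ) 1, g (ρ ^ q) = (g ρ / ρ) ^ q) {σ : ℝ} (hσ : σ ∈ Set.Ioo (0 : ℝ) 1) (hpos : 0 < g σ)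
    {A : ℝ} (hdom : ∀ ρ ∈ Set.Ioo (0 : ℝ) 1, A < g ρ → g ρ ≤ D.nrm w₀ ρ (D.Xi z w₀ j₀)) :
    ∀ M : ℝ, ∃ ρ ∈ Set.Ioc (0 : ℝ) 1, M < D.nrm w₀ ρ (D.Xi z w₀ j₀) := by
  intro M
  obtain ⟨ρ, hρ, hlt⟩ := exists_lt_of_frobeniusScaling hq hscale hσ hpos (max M A)
  exact ⟨ρ, ⟨hρ.1, hρ.2.le⟩,
    (le_max_left M A).trans_lt (hlt.trans_le (hdom ρ hρ ((le_max_right M A).trans_lt hlt)))⟩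

/-- **Thm. 7.3.1 AS TYPED from one Frobenius eigen-component in the locus** (composition of the two previous theorems): if some
member `Ξ_z` of `Θ̃^{B_{L′}}_Joshi` has all its coordinate norms at the bad places `≥ c > 0` uniformly in `ρ ∈ (0,1]` and one coordinate
dominating a Frobenius-scaling function, then `FundamentalEstimateBL` holds — WHATEVER the norms at the distinguished element
`Ξ^α_{0,z_Θ}` are (cf. `eigenDatum_profile`: it holds where the local step fails at every `ρ`). [folklore] -/
theorem fundamentalEstimateBL_of_frobeniusEigenCoordinate (z : D.Idx) {w₀ : D.W} (hw₀ : w₀ ∈ D.Vss) (j₀ : Fin D.lstar)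
    {c : ℝ} (hc : 0 < c) (hlow : ∀ ρ ∈ Set.Ioc (0 : ℝ) 1, ∀ w ∈ D.Vss, ∀ j : Fin D.lstar, c ≤ D.nrm w ρ (D.Xi z w j))
    {q : ℕ} (hq : 1 ≤ q) {g : ℝ → ℝ} (hscale : ∀ ρ ∈ Set.Ioo (0 : ℝ) 1, g (ρ ^ q) = (g ρ / ρ) ^ q)
    {σ : ℝ} (hσ : σ ∈ Set.Ioo (0 : ℝ) 1) (hpos : 0 < g σ)
    {A : ℝ} (hdom : ∀ ρ ∈ Set.Ioo (0 : ℝ) 1, A < g ρ → g ρ ≤ D.nrm w₀ ρ (D.Xi z w₀ j₀)) : D.FundamentalEstimateBL :=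
  D.fundamentalEstimateBL_of_unbounded_coordinate z hw₀ j₀ hc hlow
    (D.unbounded_of_dominates_frobeniusScaling z w₀ j₀ hq hscale hσ hpos hdom)

/-! ## 3. The literal reading with a singleton locus: the first negator of Thm. 7.3.1 as typed -/

/-- Under the LITERAL norm values (E-t11's `LiteralStandardPointNorms`, Prop. 6.6.1 «`ξ_1 = q`» read literally) the
`(B_{L′},ρ)`-size of the distinguished element is at most `∏_{w ∈ 𝕍^{odd,ss}} |q_w|` at every `ρ ∈ (0,1]`. [folklore] -/
theorem adelicSize_std_le_prod_qAbs_of_literal (h : D.LiteralStandardPointNorms) {ρ : ℝ} (hρ : ρ ∈ Set.Ioc (0 : ℝ) 1) :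
    D.adelicSize ρ (D.Xi D.std) ≤ ∏ w ∈ D.Vss, D.qAbs w := by
  rw [D.adelicSize_Xi_eq_prod]
  exact Finset.prod_le_prod (fun w _ => D.localSize_nonneg w ρ _) fun w hw => D.localSize_std_le_qAbs_of_literal h hw hρ

/-- `∏_w |q_w| < ∏_w |q_w|^{ℓ⋆/2ℓ} = qBound` as soon as `𝕍^{odd,ss} ≠ ∅` (`0 < |q_w| < 1`, exponent `< 1`). [folklore] -/
theorem prod_qAbs_lt_qBound (hne : D.Vss.Nonempty) : ∏ w ∈ D.Vss, D.qAbs w < D.qBound :=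
  Finset.prod_lt_prod_of_nonempty (fun w hw => D.qAbs_pos w hw) (fun _ hw => D.qAbs_lt_qFactor hw) hne

/-- **Thm. 7.3.1 AT EVERY FIXED `ρ ∈ (0,1]` FAILS under the literal reading when the locus is the singleton `{Ξ^α_{0,z_Θ}}`**
(`𝕍^{odd,ss} ≠ ∅`): `|Θ̃|_{B_{L′},ρ} = |Ξ^α_{0,z_Θ}|_ρ ≤ ∏_w |q_w| < qBound`. [folklore] -/
theorem not_fundamentalEstimateBLAt_of_literal_of_locus_eq (h : D.LiteralStandardPointNorms) (hne : D.Vss.Nonempty)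
    (h1 : ∀ z : D.Idx, D.Xi z = D.Xi D.std) {ρ : ℝ} (hρ : ρ ∈ Set.Ioc (0 : ℝ) 1) : ¬ D.FundamentalEstimateBLAt ρ := by
  intro hF
  have hle : D.sizeAt D.locus ρ ≤ ((∏ w ∈ D.Vss, D.qAbs w : ℝ) : EReal) := by
    refine D.sizeAt_le_coe ?_
    rintro x ⟨z, rfl⟩
    rw [h1 z]
    exact D.adelicSize_std_le_prod_qAbs_of_literal h hρ
  have h3 := EReal.coe_le_coe_iff.1 (hF.trans hle)
  exact absurd h3 (not_le.2 (D.prod_qAbs_lt_qBound hne))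

/-- **FIRST NEGATOR OF C-040: Thm. 7.3.1 AS TYPED FAILS under the literal reading when the locus is the singleton `{Ξ^α_{0,z_Θ}}`**
(`𝕍^{odd,ss} ≠ ∅`): the double supremum of Def. 7.2.7 is then `≤ ∏_w |q_w| < ∏_w |q_w|^{ℓ⋆/2ℓ}`. So, as typed, Thm. 7.3.1 is decided by
WHAT ELSE Def. 6.10.2 puts in the locus, not by the norms at the distinguished element alone. [folklore] -/
theorem not_fundamentalEstimateBL_of_literal_of_locus_eq (h : D.LiteralStandardPointNorms) (hne : D.Vss.Nonempty)
    (h1 : ∀ z : D.Idx, D.Xi z = D.Xi D.std) : ¬ D.FundamentalEstimateBL := by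
  intro hF
  have hle : D.size D.locus ≤ ((∏ w ∈ D.Vss, D.qAbs w : ℝ) : EReal) := by
    refine iSup₂_le fun ρ hρ => D.sizeAt_le_coe ?_
    rintro x ⟨z, rfl⟩
    rw [h1 z]
    exact D.adelicSize_std_le_prod_qAbs_of_literal h hρ
  have h3 := EReal.coe_le_coe_iff.1 (hF.trans hle)
  exact absurd h3 (not_le.2 (D.prod_qAbs_lt_qBound hne))

end AdelicThetaDatum

/-! ## 4. Two interface-level witness data -/

section Witnesses

/-- **`literalDatum`** — one place (`𝕍_{L′} = 𝕍^{odd,ss} = {∗}`), `ℓ⋆ = 2` (`ℓ = 5`), `B = ℝ` with `|·|_ρ = |·|`, `|q| = 1/2`, and the locus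
the SINGLETON `{Ξ^α_{0,z_Θ}}` with the LITERAL coordinate values `(|q|^{1/4}, |q|^{1})` (exponents `j²/ℓ⋆²`, no factor `1/2ℓ`).
Interface-level witness (real numbers), NOT a model of [FF18]'s rings. [folklore] -/
def literalDatum : AdelicThetaDatum where
  W := Unit
  Vss := Finset.univ
  lstar := 2
  two_le_lstar := le_rfl
  prime_ell := Nat.prime_five
  B := fun _ => ℝ
  one := fun _ => 1
  nrm := fun _ _ x => |x|
  nrm_nonneg := fun _ _ x => abs_nonneg x
  nrm_one := fun _ _ => abs_one
  top := fun _ => inferInstance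
  continuous_nrm := fun _ _ _ => continuous_abs
  Bplus := fun _ => {x | |x| ≤ 1}
  nrm_le_one_of_mem_Bplus := fun _ _ hx => hx
  Idx := Unit
  Xi := fun _ _ i => (1 / 2 : ℝ) ^ (((((i : ℕ) : ℝ) + 1) ^ 2) / ((2 : ℕ) : ℝ) ^ 2)
  Xi_off := fun _ w hw => absurd (Finset.mem_univ w) hw
  std := ()
  qAbs := fun _ => 1 / 2
  qAbs_pos := fun _ _ => by norm_num
  qAbs_lt_one := fun _ _ => by norm_num

/-- `literalDatum` carries the LITERAL norm values at its distinguished (only) element. [folklore] -/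
theorem literalDatum_literal : literalDatum.LiteralStandardPointNorms := by
  intro w _ ρ _ i
  show |(1 / 2 : ℝ) ^ (((((i : ℕ) : ℝ) + 1) ^ 2) / ((2 : ℕ) : ℝ) ^ 2)| = (1 / 2 : ℝ) ^ literalDatum.literalExponent i
  rw [abs_of_nonneg (Real.rpow_nonneg (by norm_num) _)]
  rfl

/-- **PROFILE of `literalDatum`**: the literal reading holds, the local step C-054 FAILS at every `ρ ∈ (0,1]`, and Thm. 7.3.1 AS TYPED
(C-040) FAILS, as does its fixed-`ρ` form — all in kernel. [folklore] -/
theorem literalDatum_profile {ρ : ℝ} (hρ : ρ ∈ Set.Ioc (0 : ℝ) 1) :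
    literalDatum.LiteralStandardPointNorms ∧ ¬ literalDatum.LocalThetaEstimateAt ρ ∧
      ¬ literalDatum.FundamentalEstimateBLAt ρ ∧ ¬ literalDatum.FundamentalEstimateBL :=
  have hne : literalDatum.Vss.Nonempty := ⟨(), Finset.mem_univ (α := Unit) ()⟩
  ⟨literalDatum_literal, literalDatum.not_localThetaEstimateAt_of_literal literalDatum_literal hne hρ,
    literalDatum.not_fundamentalEstimateBLAt_of_literal_of_locus_eq literalDatum_literal hne (fun _ => rfl) hρ,
    literalDatum.not_fundamentalEstimateBL_of_literal_of_locus_eq literalDatum_literal hne fun _ => rfl⟩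

/-- **`eigenDatum`** — one place, `ℓ⋆ = 2`, `B = ℝ × ℝ` with `|(a, b)|_ρ := max |a| (|b|^{1/ρ})` (first coordinate «Teichmüller-like»:
`ρ`-independent norm; second «eigen-like»: norm growing as `ρ → 0⁺` the way a Frobenius eigen-component does qualitatively;
continuous in the element, `= 1` on `one = (1, 0)`, `≤ 1` at `ρ = 1` on `B^+ := {max |a| |b| ≤ 1}`); `|q| = 1/2`; the locus has TWO
members: the distinguished one with the LITERAL values `((|q|^{1/4}, 0), (|q|, 0))` and an eigen-member `((|q|^{1/4}, 2), (|q|, 2))`.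
Interface-level witness, NOT a model of [FF18]'s rings. [folklore] -/
def eigenDatum : AdelicThetaDatum where
  W := Unit
  Vss := Finset.univ
  lstar := 2
  two_le_lstar := le_rfl
  prime_ell := Nat.prime_five
  B := fun _ => ℝ × ℝ
  one := fun _ => (1, 0)
  nrm := fun _ ρ x => max |x.1| (|x.2| ^ (1 / ρ))
  nrm_nonneg := fun _ _ x => (abs_nonneg x.1).trans (le_max_left _ _)
  nrm_one := fun _ ρ => by
    show max |(1 : ℝ)| (|(0 : ℝ)| ^ (1 / ρ)) = 1
    rw [abs_one, abs_zero]
    exact max_eq_left (Real.zero_rpow_le_one _)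
  top := fun _ => inferInstance
  continuous_nrm := fun _ ρ hρ =>
    (continuous_abs.comp continuous_fst).max
      ((continuous_abs.comp continuous_snd).rpow_const fun _ => Or.inr (by have := hρ.1; positivity))
  Bplus := fun _ => {x | max |x.1| |x.2| ≤ 1}
  nrm_le_one_of_mem_Bplus := fun _ x hx => by simpa using hx
  Idx := Bool
  Xi := fun b _ i => ((1 / 2 : ℝ) ^ (((((i : ℕ) : ℝ) + 1) ^ 2) / ((2 : ℕ) : ℝ) ^ 2), if b then 2 else 0)
  Xi_off := fun _ w hw => absurd (Finset.mem_univ w) hw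
  std := false
  qAbs := fun _ => 1 / 2
  qAbs_pos := fun _ _ => by norm_num
  qAbs_lt_one := fun _ _ => by norm_num

/-- The norm of a «Teichmüller-like» element `(a, 0)` of `eigenDatum` is `|a|` at every `ρ > 0`. [folklore] -/
theorem eigenDatum_nrm_inl (w : eigenDatum.W) {ρ : ℝ} (hρ : 0 < ρ) (a : ℝ) : eigenDatum.nrm w ρ (a, 0) = |a| := by
  show max |a| (|(0 : ℝ)| ^ (1 / ρ)) = |a|
  rw [abs_zero, Real.zero_rpow (by positivity), max_eq_left (abs_nonneg a)]

/-- `eigenDatum` carries the LITERAL norm values at its distinguished element. [folklore] -/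
theorem eigenDatum_literal : eigenDatum.LiteralStandardPointNorms := by
  intro w _ ρ hρ i
  show eigenDatum.nrm w ρ ((1 / 2 : ℝ) ^ (((((i : ℕ) : ℝ) + 1) ^ 2) / ((2 : ℕ) : ℝ) ^ 2), 0) = _
  rw [eigenDatum_nrm_inl w hρ.1, abs_of_nonneg (Real.rpow_nonneg (by norm_num) _)]
  rfl

/-- Every coordinate norm of the eigen-member is `≥ 1/2` at every `ρ` (its first component `|q|^{j²/ℓ⋆²} ≥ |q| = 1/2`). [folklore] -/
theorem eigenDatum_low (ρ : ℝ) (w : eigenDatum.W) (_hw : w ∈ eigenDatum.Vss) (j : Fin eigenDatum.lstar) :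
    (1 / 2 : ℝ) ≤ eigenDatum.nrm w ρ (eigenDatum.Xi true w j) := by
  show (1 / 2 : ℝ) ≤ max |(1 / 2 : ℝ) ^ (((((j : ℕ) : ℝ) + 1) ^ 2) / ((2 : ℕ) : ℝ) ^ 2)| (|(if true then (2 : ℝ) else 0)| ^ (1 / ρ))
  refine le_trans ?_ (le_max_left _ _)
  rw [abs_of_nonneg (Real.rpow_nonneg (by norm_num) _)]
  have hj : (((j : ℕ) : ℝ) + 1) ^ 2 / ((2 : ℕ) : ℝ) ^ 2 ≤ 1 := by
    have hj2 : (j : ℕ) + 1 ≤ 2 := j.2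
    have hj2' : ((j : ℕ) : ℝ) + 1 ≤ 2 := by exact_mod_cast hj2
    rw [div_le_one (by positivity)]
    have h0 : (0 : ℝ) ≤ ((j : ℕ) : ℝ) + 1 := by positivity
    calc (((j : ℕ) : ℝ) + 1) ^ 2 ≤ (2 : ℝ) ^ 2 := pow_le_pow_left₀ h0 hj2' 2
      _ = ((2 : ℕ) : ℝ) ^ 2 := by norm_num
  calc (1 / 2 : ℝ) = (1 / 2 : ℝ) ^ (1 : ℝ) := (Real.rpow_one _).symm
    _ ≤ (1 / 2 : ℝ) ^ (((((j : ℕ) : ℝ) + 1) ^ 2) / ((2 : ℕ) : ℝ) ^ 2) :=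
        Real.rpow_le_rpow_of_exponent_ge (by norm_num) (by norm_num) hj
      -- `|q| < 1`: a smaller exponent gives a LARGER power

/-- The eigen-coordinate's norm `max(·, 2^{1/ρ})` is unbounded over `ρ ∈ (0,1]` (at `ρ = 1/(n+1)` it is `≥ 2^{n+1} > n`). [folklore] -/
theorem eigenDatum_unbounded (w : eigenDatum.W) (j : Fin eigenDatum.lstar) :
    ∀ M : ℝ, ∃ ρ ∈ Set.Ioc (0 : ℝ) 1, M < eigenDatum.nrm w ρ (eigenDatum.Xi true w j) := by
  intro M
  obtain ⟨n, hn⟩ := exists_nat_gt M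
  have hn1 : (0 : ℝ) < (n : ℝ) + 1 := by positivity
  refine ⟨1 / ((n : ℝ) + 1), ⟨by positivity, by rw [div_le_one hn1]; linarith⟩, ?_⟩
  show M < max _ (|(if true then (2 : ℝ) else 0)| ^ (1 / (1 / ((n : ℝ) + 1))))
  refine lt_of_lt_of_le ?_ (le_max_right _ _)
  rw [if_pos rfl, one_div_one_div, abs_of_pos (by norm_num : (0 : ℝ) < 2)]
  have h2 : ((n : ℝ) + 1) < (2 : ℝ) ^ ((n : ℝ) + 1) := by
    have := Real.rpow_natCast (2 : ℝ) (n + 1)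
    push_cast at this
    rw [this]
    exact_mod_cast Nat.lt_two_pow_self
  linarith

/-- **PROFILE of `eigenDatum`**: the literal reading holds at the distinguished element, so the local step C-054 FAILS at every
`ρ ∈ (0,1]`; yet Thm. 7.3.1 AS TYPED (C-040) HOLDS — through the eigen-member alone (`|Θ̃|_{B_{L′}} = ⊤`), by
`fundamentalEstimateBL_of_unbounded_coordinate`. C-040 as typed is therefore NOT decided by C-054. [folklore] -/
theorem eigenDatum_profile {ρ : ℝ} (hρ : ρ ∈ Set.Ioc (0 : ℝ) 1) :
    eigenDatum.LiteralStandardPointNorms ∧ ¬ eigenDatum.LocalThetaEstimateAt ρ ∧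
      eigenDatum.size eigenDatum.locus = ⊤ ∧ eigenDatum.FundamentalEstimateBL :=
  have hne : eigenDatum.Vss.Nonempty := ⟨(), Finset.mem_univ (α := Unit) ()⟩
  have hmem : (() : Unit) ∈ eigenDatum.Vss := Finset.mem_univ (α := Unit) ()
  have j₀ : Fin eigenDatum.lstar := ⟨0, by decide⟩
  have htop : eigenDatum.size eigenDatum.locus = ⊤ :=
    eigenDatum.size_locus_eq_top_of_unbounded_coordinate true hmem j₀ (by norm_num : (0 : ℝ) < 1 / 2)
      (fun ρ _ w hw j => eigenDatum_low ρ w hw j) (eigenDatum_unbounded () j₀)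
  ⟨eigenDatum_literal, eigenDatum.not_localThetaEstimateAt_of_literal eigenDatum_literal hne hρ, htop,
    eigenDatum.fundamentalEstimateBL_of_size_eq_top htop⟩

end Witnesses

/-! ## 5. The census package for C-040 / C-054 (R-J; located, not adjudicated) -/

/-- **R-J CENSUS PACKAGE, rows C-040 / C-054** (kernel facts BY NAME; nothing asserted about print). For every typed §7 datum `D`:
(1) CHARITABLE reading (`StandardPointNorms`): the local step C-054 holds at every `ρ ∈ (0,1]` and Thm. 7.3.1 as typed C-040 holds
(p429865); (2) LITERAL reading (`LiteralStandardPointNorms`, `𝕍^{odd,ss} ≠ ∅`): C-054 fails at every `ρ` (E-t11 p430748), and if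
moreover the locus is `{Ξ^α_{0,z_Θ}}` then C-040 fails as typed and at every fixed `ρ`; (3) ONE member of the locus with one
`ρ`-unbounded coordinate and the others `≥ c > 0` at the bad places gives C-040 as typed, whatever happens at `Ξ^α_{0,z_Θ}`.
Witnesses: `literalDatum_profile` (¬C-054 ∧ ¬C-040), `eigenDatum_profile` (¬C-054 ∧ C-040), `toyDatum` of p429522 (C-054 ∧ C-040).
Census wording: C-054 LOCATED (decided by the reading of Prop. 6.6.1 «`ξ_1 = q`»); C-040 as typed LOCATED (decided by Def. 7.2.7's
`sup` over `ρ` + the membership of Def. 6.10.2's locus; derived under the charitable reading modulo (STD), p435150); neither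
S-bearing alone (X-05 p429522). [folklore] -/
theorem census_C040_C054 (D : AdelicThetaDatum) :
    (D.StandardPointNorms → (∀ ρ ∈ Set.Ioc (0 : ℝ) 1, D.LocalThetaEstimateAt ρ) ∧ D.FundamentalEstimateBL) ∧
    (D.LiteralStandardPointNorms → D.Vss.Nonempty →
      (∀ ρ ∈ Set.Ioc (0 : ℝ) 1, ¬ D.LocalThetaEstimateAt ρ) ∧
        ((∀ z : D.Idx, D.Xi z = D.Xi D.std) →
          (∀ ρ ∈ Set.Ioc (0 : ℝ) 1, ¬ D.FundamentalEstimateBLAt ρ) ∧ ¬ D.FundamentalEstimateBL)) ∧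
    (∀ (z : D.Idx) (w₀ : D.W), w₀ ∈ D.Vss → ∀ (j₀ : Fin D.lstar) (c : ℝ), 0 < c →
      (∀ ρ ∈ Set.Ioc (0 : ℝ) 1, ∀ w ∈ D.Vss, ∀ j : Fin D.lstar, c ≤ D.nrm w ρ (D.Xi z w j)) →
      (∀ M : ℝ, ∃ ρ ∈ Set.Ioc (0 : ℝ) 1, M < D.nrm w₀ ρ (D.Xi z w₀ j₀)) →
        D.size D.locus = ⊤ ∧ D.FundamentalEstimateBL) :=
  ⟨fun h => ⟨fun _ hρ => D.localThetaEstimateAt_of_standardPointNorms h hρ, D.fundamentalEstimateBL_of_standardPointNorms h⟩,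
    fun h hne => ⟨fun _ hρ => D.not_localThetaEstimateAt_of_literal h hne hρ, fun h1 =>
      ⟨fun _ hρ => D.not_fundamentalEstimateBLAt_of_literal_of_locus_eq h hne h1 hρ,
        D.not_fundamentalEstimateBL_of_literal_of_locus_eq h hne h1⟩⟩,
    fun z _ hw₀ j₀ _ hc hlow hunb =>
      ⟨D.size_locus_eq_top_of_unbounded_coordinate z hw₀ j₀ hc hlow hunb,
        D.fundamentalEstimateBL_of_unbounded_coordinate z hw₀ j₀ hc hlow hunb⟩⟩

end Summit.ABC.IUTFork.Joshi.ATS3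

end
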